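import Literature.MathematicalPhysics.QuantumFieldTheory.Balaban1983to89.B8DentedCubeMemberTorusClasses
import Literature.MathematicalPhysics.QuantumFieldTheory.Balaban1983to89.B8CubeMemberTorusLandau

/-!
# `Balaban1983to89.B8DentedCubeMemberTorusLandau` — TRANSPLANT STEP T3b∕T3d ON THE DENTED CUBE MEMBER of [Balaban1985Variational] (148)–(150): THE LANDAU CONDITION
# TRANSFERS — [Balaban1985RegularSpaces] (1.38) «R(U₀)D^{η*}_{U₀}A = 0» at `U₀ = 1` in multiplier form on the DENTED tower (`IsLandau138 L k η (c.sq 0) c.lamS 1 φ`,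
# NODE 00's `CubeB8D.sq ∕ lamS`) implies [Balaban1984PropagatorsII] (2.12) «R∂*A = 0» for the field transplanted to the V1 torus at `D = cubeTDomainsDented …`

statement-level skeleton of published theorems with citation tags; proofs where landed; nothing here is a claim about the
Yang–Mills mass gap

`[Balaban1985RegularSpaces]` ("B8" = [6], CMP **99** (1985) 75–102) (1.38) p. 82, (1.29) p. 81, (1.131) p. 99; `[Balaban1984PropagatorsII]` ("B6", CMP **96** (1984) 223–250)
(2.7) p. 224 («λ = 0 on Λ₀, Q′_jλ = 0 on Λ_j»), (2.10)–(2.12) p. 225 («R the orthogonal projection onto ΔN(Q′) … R∂*A = 0»); `[Balaban1985BackgroundPropagators]` ([4], CMP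
**99** (1985) 389–434) (3.19)–(3.25) pp. 393–394; `[Balaban1985Variational]` ("[15]", CMP **102** (1985) 277–309) (148)–(152) p. 301 («ū_j = 1 on Λ′_j», the local Landau
gauge on the dented sequence `{Ω′_j}`).  PDF held: `paper:balaban1985-cmp99-regular-spaces-gauge-fixing`, `paper:balaban1985-cmp102-variational-background`.

CITATION HEADER (lean-in-tree rule).  Cell `pub-ymgap` (YM Track A, HUMAN RULING D-0062), DAG node N05 = [B8], seat `pub-ymgap-dag-n05-e` (g32; FAN-OUT §N05 row s3b,
Proposition-6 lane; piece (d2-b) of the (β) road: dag-n05-c PRICE I.41357, STANDING GO I.42366; this seat INTENT I.43297).  WHY THIS FILE.  dag-n05-c's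
`B8CubeMemberTorusLandau.RE_dsE_liftB_eq_zero` (T3b) closes «(1.38) at the member ⟹ (2.12) on the torus» for the PURE cube member (a torus gauge function `n ∈ ker Q′` vanishes
off `t + □₁` and has zero block sums on `Λ_j`, so its pull-back is in the member's `N(Q′)` and `B8Eq138LandauFlatOrthogonal.pairing_covLap_eq_zero_of_isLandau138` — generic in
`Ω₀`, `Λ` — kills the `ℤ^{d+1}` pairing).  The (β) road's γ re-assembly over NODE 00's dented datum (this seat g31) carries (1.38) on the DENTED tower: `Ω′₀ = c.sq 0 = □₀`, cells
`c.lamS`.  THIS FILE is T3b's token re-key at `D = B8CubeMemberTorusDomainsDented.cubeTDomainsDented …` (p659647) through the dented dictionary `B8DentedCubeMemberTorusClasses`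
(file 1; its `not_mem_sq_one_of_mem_lamS_zero`: a level-`0` cell of the dented tower is not a site of `Ω′₁` — for `k = 1` the dent `□₁ ∖ Ω₁` lies at level `0`): §1 the two
gauge-function lemmas, §2 ★★ `RE_dsE_liftB_eq_zero`.  T3b's generic §1 (`sum_univ_labels`, `sum_boxDom_eq_finsum`, `finsum_sub_translate`) is IMPORTED by name.

WHAT THIS FILE PROVES (kernel-checked; `L = ℓ + 1 ≥ 2`; a dented datum `c : Node00.CubeB8D (d+1) (ℓ+1) K Ω` at the top truncation; side conditions and host as in file 1).
* §1 `eq_zero_of_inGauge_of_not_mem` (a gauge function of the reading vanishes off `t + Ω′₁`), `blockSum_eq_zero_of_inGauge` (its `Lʲ`-block sums vanish on `t_j + Λ′_j`,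
  `y ∈ c.lamS j`, `1 ≤ j ≤ k` — via `lamSite_iff`).
* §2 ★★ `RE_dsE_liftB_eq_zero`: `IsLandau138 (ℓ+1) c.k η (c.sq 0) c.lamS 1 φ` + deep support of `ψ = φ(· − t)` ⟹ `RE (domT hN (cubeTDomainsDented …) hk) η⁻¹ (∂*(liftB g ψ)) = 0`
  for every real functional `g` — T3b's proof verbatim with the dented suppliers (`not_mem_sq_one_of_mem_lamS_zero` of file 1 for «λ = 0 on Λ′₀»).

HONEST SCOPE ∕ NOT CLAIMED.  Bookkeeping over landed identities; no estimate.  Count-neutral; N05 ∕ N07 NOT discharged; one finite `T⁴` programme at fixed `ε`, Bałaban as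
printed; nothing continuum ∕ ℝ⁴ ∕ OS ∕ mass-gap ∕ Clay.  No `sorry`, no `def`, no `instance`, no `notation`.  Unit `pub-ymgap-dag-n05-e` (g32), 2026-08-28.

RELATED IN THE TREE, NOT DUPLICATED (`rg -l 'DentedCubeMemberTorusLandau' Balaban1983to89` = 0, 2026-08-28T21:55Z): T3b `B8CubeMemberTorusLandau` (dag-n05-c g12; the PURE member —
§1 USED by name, §2–§3 the model), `B8DentedCubeMemberTorusClasses` (this seat g32; USED), `B8Eq138LandauFlatOrthogonal.pairing_covLap_eq_zero_of_isLandau138` (p580574; USED),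
`B8CubeMemberTorusChart` ∕ `…Averages` (dag-n05-c; USED), `Node00.CubeB8D` (p655171; USED).
-/
noncomputable section

namespace Literature.MathematicalPhysics.QuantumFieldTheory.Balaban1983to89.B8DentedCubeMemberTorusLandau

open B4Reflection242 (boxDom mem_boxDom blk)
open B6MultiLevelBoxOperator (N0 bigSide)
open B6GlobalChartV1 (PV toBox)
open B6GlobalChartV1L0 (domT)
open B6SectAOperatorsV1 (dsE dE lapE QpE RE RE_eq_zero_iff mem_ker_QpE_iff lapE_apply dsE_apply inner_eq_sum ScalarSpace)
open B7Prop1Explicit (e e_apply)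
open B7Prop1Local (InBox)
open B8Ineq132 (Under)
open B8Eq131Cubes (cube sqLo sqHi inLo inHi)
open B8Eq131CubesAdmissible (cubeFam cubeFam_false_zero)
open B8Eq191FlatLettersCubeMember (inBox_finite under_iff_blockMap_eq)
open B8CubeMemberBoxDomains (shift boxP)
open B8CubeMemberTorusDomainsDented (cubeTDomainsDented levD)
open B8CubeMemberTorusChart (toTorus labels toTorus_labels labels_toTorus DeepSupp liftB liftS liftB_apply liftS_apply laplace_liftS diverg_liftB)
open B8CubeMemberTorusAverages (labelsJ sum_iterBlock_eq_sum_boxVec)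
open B8CubeMemberTorusClasses (labelsJ_iterBlockOf shiftJ shift_eq_smul_shiftJ blockMap_sub_smul mem_cube_iff_blockMap)
open B8CubeMemberTorusLandau (sum_univ_labels sum_boxDom_eq_finsum finsum_sub_translate)
open B8DentedCubeMemberTorusClasses (inBox_of_mem_lamS not_mem_sq_one_of_mem_lamS_zero deep_zero_iff lamSite_iff)
open B8Eq138LandauZd (IsLandau138 covLap covDivB)
open B8Eq191FlatStencils (covLap_flat_apply)
open B8Eq138LandauFlatOrthogonal (pairing_covLap_eq_zero_of_isLandau138)
open B5Eq118OneStroke (iterBlockOf iterBlock mem_iterBlock siteAvgIter_eq_blockSum)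
open LatticeFieldCalculus (laplace diverg siteAvgIter)
open Node00 (CubeB8D)
open Literature.MathematicalPhysics.QuantumLattice (blockMap blockSites mem_blockSites_iff)

variable {d ℓ mV KV : ℕ} {hd : 1 ≤ d + 1} {hL : Odd (ℓ + 1) ∧ 1 < ℓ + 1}

/-! ## §1 A torus gauge function pulled back to `ℤ^{d+1}` is in the dented member's `N(Q′)` -/

section Member

variable {Mh K : ℕ} {Ω : ℕ → Set (Fin (d + 1) → ℤ)} (hℓ : 1 ≤ ℓ) (hMh : 2 ≤ Mh) (c : CubeB8D (d + 1) (ℓ + 1) K Ω) {R : ℕ}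
  (hρ : Mh * (ℓ + 1) ∣ c.ρ) (hM : Mh * (ℓ + 1) ∣ c.M) (hR : R * (Mh * (ℓ + 1)) ≤ c.ρ)
  {P : Fin (d + 1) → ℕ} (hfit : ∀ μ, boxP ℓ c.M c.ρ c.k c.k μ ≤ P μ)
  (hΩ : ∀ y y' : Fin (d + 1) → ℤ, blk (bigSide ℓ Mh c.k) y' = blk (bigSide ℓ Mh c.k) y →
    (y - shift ℓ Mh c.a c.ρ c.k c.k ∈ Ω c.k ↔ y' - shift ℓ Mh c.a c.ρ c.k c.k ∈ Ω c.k))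
  (hN : ∀ μ, N0 ℓ Mh c.k P μ = (PV d ℓ mV KV hd hL).sitesPerDir 0) (hk : c.k ≤ mV + KV)

/-- **A GAUGE FUNCTION OF THE TORUS READING VANISHES OFF `t + Ω′₁`** («λ = 0 on Λ₀», `Q′₀ = id`, `Λ₀ = T ∖ (t + Ω′₁)`).
[cite: Balaban1984PropagatorsII, (2.7) p.224 («λ = 0 on Λ₀»), (2.14) p.225 («(Q′₀λ)(x) = λ(x), x ∈ Λ₀»); Balaban1985Variational, (150) p.301; Balaban1985RegularSpaces, (1.131) p.99] -/
theorem eq_zero_of_inGauge_of_not_mem {nf : Site (PV d ℓ mV KV hd hL) 0 → ℝ} (hn' : (domT hN (cubeTDomainsDented hℓ hMh c hρ hM hR P hfit hΩ) hk).InGauge nf)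
    {y : Site (PV d ℓ mV KV hd hL) 0} (hy : labels y - shift ℓ Mh c.a c.ρ c.k c.k ∉ c.sq 1) : nf y = 0 := by
  have h := hn' 0 y ⟨by rw [(domT hN _ hk).Om_zero]; exact Finset.mem_univ _, by
    rw [deep_zero_iff hℓ hMh c hρ hM hR hfit hΩ hN hk]; exact hy⟩
  simpa [siteAvgIter] using h

/-- **THE BLOCK SUMS OF A GAUGE FUNCTION VANISH ON THE DENTED MEMBER's `Λ′_j`** (`1 ≤ j ≤ k`): for `y ∈ c.lamS j` (coarse, untranslated) the sum of `nf ∘ toTorus` over the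
`Lʲ`-block of `y + t_j` is zero («Q′_jλ = 0 on Λ_j»). [cite: Balaban1984PropagatorsII, (2.7) p.224 («Q′_jλ = 0 on Λ_j, j = 1, …, k»); Balaban1985RegularSpaces, (1.29) p.81, (1.131) p.99; Balaban1985Variational, (148) p.301, (152) p.301] -/
theorem blockSum_eq_zero_of_inGauge {nf : Site (PV d ℓ mV KV hd hL) 0 → ℝ} (hn' : (domT hN (cubeTDomainsDented hℓ hMh c hρ hM hR P hfit hΩ) hk).InGauge nf)
    {j : ℕ} (hj1 : 1 ≤ j) (hjk : j ≤ c.k) {y : Fin (d + 1) → ℤ} (hy : y ∈ c.lamS j) :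
    ∑ w ∈ blockSites ((ℓ + 1) ^ j) (y + shiftJ ℓ Mh c.a c.ρ c.k c.k j), nf (toTorus (hd := hd) (hL := hL) (mV := mV) (KV := KV) (ℓ := ℓ) w) = 0 := by
  classical
  have hj : j ≤ mV + KV := hjk.trans hk
  have hLj : 0 < (ℓ + 1) ^ j := pow_pos (Nat.succ_pos ℓ) j
  have hρ0 : 0 < c.ρ := lt_of_lt_of_le (Nat.succ_pos ℓ) c.L_le_ρ
  haveI : NeZero ((ℓ + 1) ^ j) := ⟨hLj.ne'⟩
  -- `y` is a label of `□_j^{(j)}`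
  have hsq : InBox (sqLo (ℓ + 1) c.a c.ρ c.k j) (sqHi (ℓ + 1) c.a c.M c.ρ c.k j) y := inBox_of_mem_lamS c hy
  -- the coarse torus site over `y + t_j`: its labels are `y + t_j` (deep enough to be in range)
  set cc : Fin (d + 1) → ℤ := y + shiftJ ℓ Mh c.a c.ρ c.k c.k j with hcc
  -- a fine corner in the box: `Lʲ·cc` is the translate of `Lʲ·y ∈ □_j ⊂ □₀`
  have hcorner : (((ℓ + 1) ^ j : ℕ) : ℤ) • cc - shift ℓ Mh c.a c.ρ c.k c.k ∈ cube (ℓ + 1) c.a c.M c.ρ c.k j := by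
    rw [shift_eq_smul_shiftJ ℓ Mh c.a hjk le_rfl, hcc, smul_add, add_sub_cancel_right, Nat.cast_pow]
    exact (B8Eq131CubesAdmissible.smul_mem_cube_iff (Nat.succ_pos ℓ) c.a c.M c.ρ c.k j y).2 hsq
  have hcorner0 : (((ℓ + 1) ^ j : ℕ) : ℤ) • cc - shift ℓ Mh c.a c.ρ c.k c.k ∈ cube (ℓ + 1) c.a c.M c.ρ c.k 0 :=
    B8Eq131Cubes.cube_anti (Nat.zero_le j) hjk hcorner
  have hdeep := B8CubeMemberTorusDomainsL0.siteDeep_shift_of_mem_cube_zero hℓ hMh c.a c.one_le_k le_rfl hfit hcorner0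
  rw [sub_add_cancel] at hdeep
  have hinbox : ∀ μ, 0 ≤ ((((ℓ + 1) ^ j : ℕ) : ℤ) • cc) μ ∧ ((((ℓ + 1) ^ j : ℕ) : ℤ) • cc) μ < ((PV d ℓ mV KV hd hL).sitesPerDir 0 : ℕ) := by
    intro μ
    obtain ⟨h1, h2⟩ := hdeep μ
    rw [hN μ] at h2
    have h0 : (0 : ℤ) < ((c.ρ * (ℓ + 1) ^ c.k : ℕ) : ℤ) := by exact_mod_cast Nat.mul_pos hρ0 (pow_pos (Nat.succ_pos ℓ) c.k)
    exact ⟨le_trans h0.le h1, by linarith⟩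
  set x₀ : Site (PV d ℓ mV KV hd hL) 0 := toTorus ((((ℓ + 1) ^ j : ℕ) : ℤ) • cc) with hx₀
  have hlab : labels x₀ = (((ℓ + 1) ^ j : ℕ) : ℤ) • cc := labels_toTorus hinbox
  have hcoarse : labelsJ (iterBlockOf j x₀) = cc := by
    rw [labelsJ_iterBlockOf hj, hlab]
    have := blockMap_sub_smul (d := d) hLj 0 cc
    simp only [zero_sub] at this
    funext μ
    simp only [blockMap, Pi.smul_apply, smul_eq_mul]
    rw [mul_comm, Int.mul_ediv_cancel _ (by exact_mod_cast hLj.ne')]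
  -- `LamSite j (iterBlockOf j x₀)`: by the cell dictionary of file 1
  have hLam : (domT hN (cubeTDomainsDented hℓ hMh c hρ hM hR P hfit hΩ) hk).LamSite j (iterBlockOf j x₀) := by
    rw [lamSite_iff hℓ hMh c hρ hM hR hfit hΩ hN hk hj1 hjk, hcoarse, hcc, add_sub_cancel_right]
    exact hy
  -- the block average vanishes, hence the block sum
  have havg := hn' j (iterBlockOf j x₀) hLam
  rw [siteAvgIter_eq_blockSum j hj] at havg
  have hLd : ((((ℓ + 1 : ℕ) : ℝ) ^ (d + 1)) ^ j)⁻¹ ≠ 0 := by positivity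
  have hsum : ∑ x ∈ iterBlock j (iterBlockOf j x₀), nf x = 0 := by
    have h' : ((((PV d ℓ mV KV hd hL).L : ℝ) ^ (PV d ℓ mV KV hd hL).d) ^ j)⁻¹ • ∑ x ∈ iterBlock j (iterBlockOf j x₀), nf x = 0 := havg
    rw [smul_eq_zero] at h'
    rcases h' with h' | h'
    · exact absurd h' hLd
    · exact h'
  -- read the block through the labels
  have hread : ∑ x ∈ iterBlock j (iterBlockOf j x₀), nf x =
      ∑ x ∈ iterBlock j (iterBlockOf j x₀), (fun w => nf (toTorus (hd := hd) (hL := hL) (mV := mV) (KV := KV) (ℓ := ℓ) w)) (labels x) := by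
    refine Finset.sum_congr rfl fun x _ => ?_
    simp only [toTorus_labels]
  rw [hread, sum_iterBlock_eq_sum_boxVec hj (iterBlockOf j x₀) (fun w => nf (toTorus (hd := hd) (hL := hL) (mV := mV) (KV := KV) (ℓ := ℓ) w))] at hsum
  rw [hcoarse] at hsum
  -- the integer box `Lʲ·cc + [0, Lʲ)^{d+1}` is `blockSites (Lʲ) cc`
  rw [← hsum]
  symm
  refine Finset.sum_nbij (fun r => (((ℓ + 1) ^ j : ℕ) : ℤ) • cc + B7Prop1Explicit.boxVec ((ℓ + 1) ^ j) r) (fun r _ => ?_) (fun r _ r' _ h => ?_) (fun w hw => ?_)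
    (fun _ _ => rfl)
  · rw [mem_blockSites_iff]
    funext μ
    simp only [blockMap, Pi.add_apply, Pi.smul_apply, smul_eq_mul, B7Prop1Explicit.boxVec]
    have h2 : ((r μ : ℕ) : ℤ) < (((ℓ + 1) ^ j : ℕ) : ℤ) := by exact_mod_cast (r μ).isLt
    have h0 : (0 : ℤ) ≤ ((r μ : ℕ) : ℤ) := by positivity
    rw [show (((ℓ + 1) ^ j : ℕ) : ℤ) * cc μ + ((r μ : ℕ) : ℤ) = ((r μ : ℕ) : ℤ) + cc μ * (((ℓ + 1) ^ j : ℕ) : ℤ) by ring,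
      Int.add_mul_ediv_right _ _ (by exact_mod_cast hLj.ne'), Int.ediv_eq_zero_of_lt h0 h2, zero_add]
  · have h' : ∀ μ, ((r μ : ℕ) : ℤ) = ((r' μ : ℕ) : ℤ) := fun μ => by
      have := congrFun h μ; simpa [B7Prop1Explicit.boxVec] using this
    funext μ; exact Fin.ext (by exact_mod_cast h' μ)
  · rw [Finset.mem_coe, mem_blockSites_iff] at hw
    refine ⟨fun μ => ⟨(w μ - (((ℓ + 1) ^ j : ℕ) : ℤ) * cc μ).toNat, ?_⟩, Finset.mem_coe.2 (Finset.mem_univ _), ?_⟩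
    · have hμ := congrFun hw μ
      simp only [blockMap] at hμ
      have h1 := Int.ediv_mul_le (w μ) (by exact_mod_cast hLj.ne' : (((ℓ + 1) ^ j : ℕ) : ℤ) ≠ 0)
      have h2 := Int.lt_ediv_add_one_mul_self (w μ) (by exact_mod_cast hLj : (0 : ℤ) < (((ℓ + 1) ^ j : ℕ) : ℤ))
      rw [hμ] at h1 h2
      have : w μ - (((ℓ + 1) ^ j : ℕ) : ℤ) * cc μ < (((ℓ + 1) ^ j : ℕ) : ℤ) := by linarith
      omega
    · funext μ
      have hμ := congrFun hw μ
      simp only [blockMap] at hμ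
      have h1 := Int.ediv_mul_le (w μ) (by exact_mod_cast hLj.ne' : (((ℓ + 1) ^ j : ℕ) : ℤ) ≠ 0)
      rw [hμ] at h1
      simp only [Pi.add_apply, Pi.smul_apply, smul_eq_mul, B7Prop1Explicit.boxVec]
      rw [Int.toNat_of_nonneg (by linarith)]
      ring

/-! ## §2 The Landau condition transfers -/

/-- ★★ **(1.38) ON THE DENTED TOWER ⟹ (2.12) ON THE TORUS**: let `φ` be a `ℂ`-valued bond field of `ℤ^{d+1}` in the flat Landau gauge (1.38) of the DENTED cube member in
multiplier form (`IsLandau138 (ℓ+1) c.k η (c.sq 0) c.lamS 1 φ`: `Ω′₀ = □₀`, cells `Λ′_j = c.lamS j`), and `ψ = φ(· − t)` its translate, supported `2`-deep in the fundamental box;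
then for every real functional `g` the transplanted torus field `A = liftB g ψ` satisfies «`R∂*A = 0`» for the torus reading's projection `R = RE (domT hN D hk) η⁻¹`,
`D = cubeTDomainsDented …`.  Proof = dag-n05-c's T3b proof with the dented suppliers: `RE_eq_zero_iff` (p21) reduces to `⟪Δn, ∂*A⟫ = 0` for gauge functions `n`; §2 makes the
pull-back `λ(z) = n(toTorus (z + t))·𝟙_{□₀}(z)` an element of the dented member's `N(Q′)` (zero off `Ω′₁`, zero block sums on `Λ′_j`); `pairing_covLap_eq_zero_of_isLandau138`
(p580574) kills the `ℤ^{d+1}` pairing. [cite: Balaban1985RegularSpaces, (1.38) p.82, (1.29) p.81; Balaban1985Variational, (148)–(152) p.301; Balaban1984PropagatorsII, (2.7) p.224, (2.10)–(2.12) p.225; Balaban1985BackgroundPropagators, (3.19) p.393, (3.24)–(3.25) p.394] -/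
theorem RE_dsE_liftB_eq_zero {η : ℝ} {φ : (Fin (d + 1) → ℤ) → Fin (d + 1) → ℂ}
    (hLan : IsLandau138 (ℓ + 1) c.k η (c.sq 0) c.lamS (1 : (Fin (d + 1) → ℤ) → Fin (d + 1) → ℂˣ) φ)
    (hψ : DeepSupp ((PV d ℓ mV KV hd hL).sitesPerDir 0) 2 (fun w => φ (w - shift ℓ Mh c.a c.ρ c.k c.k)))
    (h2N : (2 : ℤ) ≤ ((PV d ℓ mV KV hd hL).sitesPerDir 0 : ℕ)) (g : ℂ →ₗ[ℝ] ℝ) :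
    RE (domT hN (cubeTDomainsDented hℓ hMh c hρ hM hR P hfit hΩ) hk) η⁻¹
      (dsE η⁻¹ (WithLp.toLp 2 (liftB (hd := hd) (hL := hL) (mV := mV) (KV := KV) (ℓ := ℓ) g (fun w => φ (w - shift ℓ Mh c.a c.ρ c.k c.k))))) = 0 := by
  classical
  set t := shift ℓ Mh c.a c.ρ c.k c.k with ht
  set ψ : (Fin (d + 1) → ℤ) → Fin (d + 1) → ℂ := fun w => φ (w - t) with hψdef
  have hL1 : 1 ≤ ℓ + 1 := Nat.succ_pos ℓ
  have hρ0 : 0 < c.ρ := lt_of_lt_of_le (Nat.succ_pos ℓ) c.L_le_ρ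
  have hρL : ℓ + 1 ≤ c.ρ := c.L_le_ρ
  have hsq1 : c.sq 1 ⊆ cube (ℓ + 1) c.a c.M c.ρ c.k 1 := c.sq_subset_cube c.one_le_k
  rw [RE_eq_zero_iff]
  intro nvec hnvec
  rw [mem_ker_QpE_iff] at hnvec
  set nf : Site (PV d ℓ mV KV hd hL) 0 → ℝ := WithLp.ofLp nvec with hnf
  -- the pull-back `fR(w) = n(toTorus w)·𝟙_{t + □₀}(w)` (translated coordinates), as a real and as a complex function
  set fR : (Fin (d + 1) → ℤ) → ℝ := fun w =>
    if w - t ∈ cube (ℓ + 1) c.a c.M c.ρ c.k 0 then nf (toTorus (hd := hd) (hL := hL) (mV := mV) (KV := KV) (ℓ := ℓ) w) else 0 with hfRdef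
  set f : (Fin (d + 1) → ℤ) → ℂ := fun w => ((fR w : ℝ) : ℂ) with hfdef
  -- `fR` vanishes unless `w − t ∈ Ω′₁`
  have hfR1 : ∀ w, w - t ∉ c.sq 1 → fR w = 0 := by
    intro w hw
    simp only [hfRdef]
    split_ifs with h0
    · have hbox : ∀ μ, 0 ≤ w μ ∧ w μ < ((PV d ℓ mV KV hd hL).sitesPerDir 0 : ℕ) := by
        intro μ
        have hdp := B8CubeMemberTorusDomainsL0.siteDeep_shift_of_mem_cube_zero hℓ hMh c.a c.one_le_k le_rfl hfit h0 μ
        rw [sub_add_cancel, hN μ] at hdp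
        have : (0 : ℤ) < ((c.ρ * (ℓ + 1) ^ c.k : ℕ) : ℤ) := by exact_mod_cast Nat.mul_pos hρ0 (pow_pos (Nat.succ_pos ℓ) c.k)
        exact ⟨by linarith [hdp.1], by linarith [hdp.2]⟩
      have hy : labels (toTorus (hd := hd) (hL := hL) (mV := mV) (KV := KV) (ℓ := ℓ) w) - t ∉ c.sq 1 := by
        rw [labels_toTorus hbox]; exact hw
      exact eq_zero_of_inGauge_of_not_mem hℓ hMh c hρ hM hR hfit hΩ hN hk hnvec hy
    · rfl
  have hf1 : ∀ w, w - t ∉ c.sq 1 → f w = 0 := fun w hw => by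
    simp only [hfdef, hfR1 w hw, Complex.ofReal_zero]
  -- `f` is supported deep (in `t + Ω′₁ ⊂ t + □₀`, which is `ρLᵏ`-deep)
  have hfdeep : DeepSupp ((PV d ℓ mV KV hd hL).sitesPerDir 0) 2 f := by
    intro w hw μ
    have h1 : w - t ∈ c.sq 1 := by by_contra h; exact hw (hf1 w h)
    have h0 : w - t ∈ cube (ℓ + 1) c.a c.M c.ρ c.k 0 := B8Eq131Cubes.cube_anti (Nat.zero_le 1) c.one_le_k (hsq1 h1)
    have hdp := B8CubeMemberTorusDomainsL0.siteDeep_shift_of_mem_cube_zero hℓ hMh c.a c.one_le_k le_rfl hfit h0 μ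
    rw [sub_add_cancel, hN μ] at hdp
    have hρn : (4 : ℤ) ≤ ((c.ρ * (ℓ + 1) ^ c.k : ℕ) : ℤ) := by
      have h2n : 2 ≤ (ℓ + 1) ^ c.k := le_trans (by omega : 2 ≤ ℓ + 1) (Nat.le_self_pow (by have := c.one_le_k; omega) _)
      have : 2 * 2 ≤ c.ρ * (ℓ + 1) ^ c.k := Nat.mul_le_mul (by omega) h2n
      exact_mod_cast this
    exact ⟨by linarith [hdp.1], by linarith [hdp.2]⟩
  -- `nf = liftS re f` on the torus
  have hnf_lift : WithLp.ofLp nvec = liftS (hd := hd) (hL := hL) (mV := mV) (KV := KV) (ℓ := ℓ) Complex.reLm f := by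
    funext y
    rw [liftS_apply]
    simp only [Complex.reLm_coe, hfdef, Complex.ofReal_re, hfRdef]
    split_ifs with h0
    · rw [toTorus_labels]
    · have h1 : labels y - t ∉ c.sq 1 := fun h => h0 (B8Eq131Cubes.cube_anti (Nat.zero_le 1) c.one_le_k (hsq1 h))
      exact eq_zero_of_inGauge_of_not_mem hℓ hMh c hρ hM hR hfit hΩ hN hk hnvec h1
  -- `Δ^η_1 f` is real: `Δf = ofReal ∘ R`
  set Rf : (Fin (d + 1) → ℤ) → ℝ := fun w => ∑ μ : Fin (d + 1), (η ^ 2)⁻¹ * (2 * fR w - fR (w + e μ) - fR (w - e μ)) with hRdef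
  have hLapreal : ∀ w, covLap η (1 : (Fin (d + 1) → ℤ) → Fin (d + 1) → ℂˣ) f w = ((Rf w : ℝ) : ℂ) := by
    intro w
    rw [B8Ineq159FlatShellModeCrossingDatum.covLap_flat_mul]
    simp only [hRdef, hfdef]
    push_cast
    rfl
  -- the torus inner product as a sum over labels
  rw [inner_eq_sum]
  have hterm : ∀ y : Site (PV d ℓ mV KV hd hL) 0,
      lapE η⁻¹ nvec y * dsE η⁻¹ (WithLp.toLp 2 (liftB (hd := hd) (hL := hL) (mV := mV) (KV := KV) (ℓ := ℓ) g ψ)) y =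
        g (covLap η (1 : (Fin (d + 1) → ℤ) → Fin (d + 1) → ℂˣ) f (labels y) * covDivB η (1 : (Fin (d + 1) → ℤ) → Fin (d + 1) → ℂˣ) ψ (labels y)) := by
    intro y
    rw [lapE_apply, dsE_apply, WithLp.ofLp_toLp, hnf_lift, laplace_liftS (by norm_num) h2N Complex.reLm hfdeep, diverg_liftB (by norm_num) h2N g hψ,
      hLapreal]
    simp only [Complex.reLm_coe, Complex.ofReal_re]
    rw [← Complex.real_smul, LinearMap.map_smul_of_tower, smul_eq_mul]
  simp only [hterm]
  rw [← map_sum, sum_univ_labels hN (fun w => covLap η (1 : (Fin (d + 1) → ℤ) → Fin (d + 1) → ℂˣ) f w * covDivB η 1 ψ w)]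
  -- off the box both factors need not vanish, but `Δf` does: `f` is 2-deep
  have hoff : ∀ w, w ∉ boxDom (N0 ℓ Mh c.k P) → covLap η (1 : (Fin (d + 1) → ℤ) → Fin (d + 1) → ℂˣ) f w * covDivB η 1 ψ w = 0 := by
    intro w hw
    have hz : ∀ v : Fin (d + 1) → ℤ, (∀ μ, |v μ| ≤ 1) → f (w + v) = 0 := by
      intro v hv
      by_contra hne
      apply hw
      rw [mem_boxDom]
      intro μ
      obtain ⟨h1, h2⟩ := hfdeep (w + v) hne μ
      have hvμ := abs_le.mp (hv μ)
      rw [hN μ]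
      simp only [Pi.add_apply] at h1 h2
      exact ⟨by linarith, by linarith⟩
    rw [covLap_flat_apply]
    have h0 : f w = 0 := by have := hz 0 (fun μ => by simp); rwa [add_zero] at this
    have hp : ∀ μ, f (w + e μ) = 0 := fun μ => hz (e μ) (fun κ => by rw [e_apply]; split_ifs <;> simp)
    have hm : ∀ μ, f (w - e μ) = 0 := fun μ => by
      rw [sub_eq_add_neg]; exact hz (-e μ) (fun κ => by rw [Pi.neg_apply, e_apply]; split_ifs <;> simp)
    simp [h0, hp, hm]
  rw [sum_boxDom_eq_finsum _ hoff]
  -- translate back to the member's coordinates: `w = z + t`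
  have htrans : ∑ᶠ w, covLap η (1 : (Fin (d + 1) → ℤ) → Fin (d + 1) → ℂˣ) f w * covDivB η 1 ψ w =
      ∑ᶠ z, covLap η (1 : (Fin (d + 1) → ℤ) → Fin (d + 1) → ℂˣ) (fun z => f (z + t)) z * covDivB η 1 φ z := by
    rw [← finsum_sub_translate (-t)]
    refine finsum_congr fun z => ?_
    simp only [sub_neg_eq_add]
    congr 1
    · rw [covLap_flat_apply, covLap_flat_apply]
      refine Finset.sum_congr rfl fun μ _ => ?_
      simp only [add_right_comm _ t]
      rw [show z + t - e μ = z - e μ + t by abel]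
    · simp only [covDivB, B8Eq191FlatStencils.covDeriv_flat_apply, hψdef, add_sub_cancel_right]
      refine Finset.sum_congr rfl fun μ _ => ?_
      rw [show z + t - e μ - t = z - e μ by abel]
  rw [htrans]
  -- the pull-back `λ(z) = f(z + t)` is in the dented member's `N(Q′)`
  set lam : (Fin (d + 1) → ℤ) → ℂ := fun z => f (z + t) with hlam
  have hsupp : ∀ z, z ∉ c.sq 0 → lam z = 0 := by
    intro z hz
    rw [c.sq_zero] at hz
    simp only [hlam, hfdef, hfRdef, add_sub_cancel_right, if_neg hz, Complex.ofReal_zero]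
  have h0lev : ∀ z ∈ c.lamS 0, lam z = 0 := by
    intro z hz
    have hz1 := not_mem_sq_one_of_mem_lamS_zero c hz
    simp only [hlam]
    exact hf1 (z + t) (by rwa [add_sub_cancel_right])
  have hQ : ∀ j, 1 ≤ j → j ≤ c.k → ∀ y ∈ c.lamS j, ∑ z ∈ blockSites ((ℓ + 1) ^ j) y, lam z = 0 := by
    intro j hj1 hjk y hy
    have hLj : 0 < (ℓ + 1) ^ j := pow_pos hL1 j
    haveI : NeZero ((ℓ + 1) ^ j) := ⟨hLj.ne'⟩
    have key := blockSum_eq_zero_of_inGauge hℓ hMh c hρ hM hR hfit hΩ hN hk hnvec hj1 hjk hy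
    -- `blockSites (Lʲ) (y + t_j) = blockSites (Lʲ) y + t` and on it `f = n ∘ toTorus`
    have hsq : InBox (sqLo (ℓ + 1) c.a c.ρ c.k j) (sqHi (ℓ + 1) c.a c.M c.ρ c.k j) y := inBox_of_mem_lamS c hy
    have hmemcube : ∀ z ∈ blockSites ((ℓ + 1) ^ j) y, z ∈ cube (ℓ + 1) c.a c.M c.ρ c.k 0 := by
      intro z hz
      rw [mem_blockSites_iff] at hz
      exact B8Eq131Cubes.cube_anti (Nat.zero_le j) hjk ((mem_cube_iff_blockMap hL1 z).2 (by rw [hz]; exact hsq))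
    have ht' : t = (((ℓ + 1) ^ j : ℕ) : ℤ) • shiftJ ℓ Mh c.a c.ρ c.k c.k j := shift_eq_smul_shiftJ ℓ Mh c.a hjk le_rfl
    -- reindex `z ↦ z + t` : `blockSites (Lʲ) y → blockSites (Lʲ) (y + t_j)`
    have hreidx : ∑ z ∈ blockSites ((ℓ + 1) ^ j) y, nf (toTorus (hd := hd) (hL := hL) (mV := mV) (KV := KV) (ℓ := ℓ) (z + t)) =
        ∑ w ∈ blockSites ((ℓ + 1) ^ j) (y + shiftJ ℓ Mh c.a c.ρ c.k c.k j), nf (toTorus (hd := hd) (hL := hL) (mV := mV) (KV := KV) (ℓ := ℓ) w) := by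
      refine Finset.sum_nbij (fun z => z + t) (fun z hz => ?_) (fun z _ z' _ h => by simpa using h) (fun w hw => ?_) (fun _ _ => rfl)
      · rw [mem_blockSites_iff] at hz ⊢
        rw [ht', show z + (((ℓ + 1) ^ j : ℕ) : ℤ) • shiftJ ℓ Mh c.a c.ρ c.k c.k j = z - (((ℓ + 1) ^ j : ℕ) : ℤ) • (-shiftJ ℓ Mh c.a c.ρ c.k c.k j) by
          rw [smul_neg, sub_neg_eq_add], blockMap_sub_smul hLj, hz, sub_neg_eq_add]
      · rw [Finset.mem_coe, mem_blockSites_iff] at hw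
        refine ⟨w - t, ?_, by simp⟩
        rw [Finset.mem_coe, mem_blockSites_iff, ht', blockMap_sub_smul hLj, hw, add_sub_cancel_right]
    have hlamval : ∀ z ∈ blockSites ((ℓ + 1) ^ j) y, lam z = ((nf (toTorus (hd := hd) (hL := hL) (mV := mV) (KV := KV) (ℓ := ℓ) (z + t)) : ℝ) : ℂ) := by
      intro z hz
      simp only [hlam, hfdef, hfRdef, add_sub_cancel_right, if_pos (hmemcube z hz)]
    rw [Finset.sum_congr rfl hlamval, ← Complex.ofReal_sum, hreidx, key, Complex.ofReal_zero]
  -- off `□₀` the pull-back and its neighbours vanish, so the pairing can be cut off by `𝟙_{□₀}`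
  have hΩfin : (c.sq 0).Finite := by rw [c.sq_zero, ← cubeFam_false_zero]; exact inBox_finite _ _
  have hlam_near : ∀ z, z ∉ cube (ℓ + 1) c.a c.M c.ρ c.k 0 → ∀ v : Fin (d + 1) → ℤ, (∀ μ, |v μ| ≤ 1) → lam (z + v) = 0 := by
    intro z hz v hv
    simp only [hlam]
    refine hf1 _ ?_
    rw [add_sub_cancel_right]
    intro h1
    obtain ⟨i, hi⟩ := B8CubeMemberBoxDomains.collar_gap c.a (lt_of_lt_of_le Nat.zero_lt_one c.one_le_k) hz (hsq1 h1)
    have hvi := abs_le.mp (hv i)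
    simp only [Pi.add_apply, pow_zero, mul_one] at hi
    rw [show z i - (z i + v i) = -v i by ring, abs_neg] at hi
    have : (c.ρ : ℤ) < 1 := lt_of_lt_of_le hi (abs_le.mpr ⟨by linarith, by linarith⟩)
    have : (2 : ℤ) ≤ c.ρ := by exact_mod_cast (show 2 ≤ c.ρ by omega)
    linarith
  have hcut : ∑ᶠ z, covLap η (1 : (Fin (d + 1) → ℤ) → Fin (d + 1) → ℂˣ) lam z * covDivB η 1 φ z =
      ∑ᶠ z, covLap η (1 : (Fin (d + 1) → ℤ) → Fin (d + 1) → ℂˣ) lam z * (c.sq 0).indicator (covDivB η 1 φ) z := by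
    refine finsum_congr fun z => ?_
    by_cases hz : z ∈ c.sq 0
    · rw [Set.indicator_of_mem hz]
    · rw [Set.indicator_of_notMem hz, mul_zero]
      rw [c.sq_zero] at hz
      have h0 : lam z = 0 := by have := hlam_near z hz 0 (fun μ => by simp); rwa [add_zero] at this
      have hp : ∀ μ, lam (z + e μ) = 0 := fun μ => hlam_near z hz (e μ) (fun κ => by rw [e_apply]; split_ifs <;> simp)
      have hm : ∀ μ, lam (z - e μ) = 0 := fun μ => by
        rw [sub_eq_add_neg]; exact hlam_near z hz (-e μ) (fun κ => by rw [Pi.neg_apply, e_apply]; split_ifs <;> simp)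
      rw [covLap_flat_apply]
      simp [h0, hp, hm]
  rw [hcut, pairing_covLap_eq_zero_of_isLandau138 hL1 hΩfin hLan hsupp h0lev hQ, map_zero]

end Member

end Literature.MathematicalPhysics.QuantumFieldTheory.Balaban1983to89.B8DentedCubeMemberTorusLandau
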